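import Mathlib
import Summits.KontsevichZagierPeriods.KontsevichZagierPeriods.Theorems.SoloInformedParamIntegrable
import HarnessLib

/-!
# Solo-informed (A390-ii): parametrised terms with INTEGRABLE admissibility

File F6b — the real-parameter kernel for arbitrary (not necessarily bounded) `KZ_ℝ` chains, step 1.
The parametrised terms are those of `SoloInformedParamTerm`; what changes is admissibility: a
parameter `p` is *I-admissible* for `T` if the graph fibre is functional and the hybrid integrand
is absolutely integrable on the domain fibre (`SoloInformedAdmI`) — exactly what an integral
representation `KZOver.IntegralRep ℝ d` requires.  The denoted representation `T.repI p`, its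
rational form at parameters with `ℚ`-semialgebraic fibres (`ratRepI`), invariance under pull-back
(`repI_pullback`), and — by KERNEL LEMMA I in parameter coordinates — the `ℚ`-semialgebraicity of
the I-admissible locus (`isSemialgebraic_setOf_admI`, conditional on the Lion–Rolin preparation
fact).  Bounded admissibility implies I-admissibility with the same denotation (`repI_eq_rep`).
-/

noncomputable section

open MeasureTheory Set
open Literature.ModelTheory.ExponentialFields Literature.NumberTheory.Transcendental

namespace Summit.KontsevichZagierPeriods.KontsevichZagierPeriods.Theorems

namespace SoloInformedPTerm

variable {K K' : Type} {d : ℕ}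

/-- **I-admissible parameter**: functional graph fibre and absolutely integrable hybrid integrand
on the domain fibre. [cite: KontsevichZagier2001, §1.1] -/
def SoloInformedAdmI (T : SoloInformedPTerm K d) (p : K → ℝ) : Prop :=
  T.SoloInformedFunctional p ∧ IntegrableOn (T.hybrid p) (T.fibre p)

variable {T : SoloInformedPTerm K d} {p : K → ℝ}

/-- Bounded admissibility implies I-admissibility. [cite: KontsevichZagier2001, §1.1] -/
theorem admI_of_adm (h : T.SoloInformedAdm p) : T.SoloInformedAdmI p :=
  ⟨h.1, integrableOn_hybrid h⟩

variable (T p)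

/-- **The representation denoted at an I-admissible parameter** (the junk representation
otherwise). [cite: KontsevichZagier2001, §1.1] -/
def repI : KZOver.IntegralRep ℝ d := by
  classical
  exact if h : T.SoloInformedAdmI p then
    { domain := T.fibre p
      integrand := T.hybrid p
      isSemialgebraic_domain := T.isSemialgebraic_fibre p
      isSemialgebraicFunOn_integrand := isSemialgebraicFunOn_hybrid h.1
      integrableOn := h.2 }
  else T.junkRep

variable {T p}

/-- Domain of the denoted representation. [cite: KontsevichZagier2001, §1.1] -/
theorem repI_domain (h : T.SoloInformedAdmI p) : (T.repI p).domain = T.fibre p := by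
  unfold repI
  rw [dif_pos h]

/-- Integrand of the denoted representation. [cite: KontsevichZagier2001, §1.1] -/
theorem repI_integrand (h : T.SoloInformedAdmI p) : (T.repI p).integrand = T.hybrid p := by
  unfold repI
  rw [dif_pos h]

/-- The denoted representation at a parameter that is not I-admissible.
[cite: KontsevichZagier2001, §1.1] -/
theorem repI_of_not_admI (h : ¬ T.SoloInformedAdmI p) : T.repI p = T.junkRep := by
  unfold repI
  rw [dif_neg h]

/-- At a boundedly admissible parameter the two denotations agree.
[cite: KontsevichZagier2001, §1.1] -/
theorem repI_eq_rep (h : T.SoloInformedAdm p) : T.repI p = T.rep p :=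
  KZOver.IntegralRep.ext (by rw [repI_domain (admI_of_adm h), rep_domain h])
    (by rw [repI_integrand (admI_of_adm h), rep_integrand h])

/-- A representation is denoted at `p` as soon as its domain is the fibre, the graph of its
integrand over the domain is the graph fibre, and the ambient function agrees with the integrand
off the domain (integrability is inherited from the representation).
[cite: KontsevichZagier2001, §1.1] -/
theorem repI_eq_of_graph (r : KZOver.IntegralRep ℝ d) (hdom : r.domain = T.fibre p)
    (hgraph : ∀ x ∈ T.fibre p, ∀ t : ℝ, Fin.snoc x t ∈ T.gfibre p ↔ t = r.integrand x)
    (hφ : ∀ x ∉ T.fibre p, T.φ x = r.integrand x) : T.repI p = r := by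
  have hf : T.SoloInformedFunctional p := fun x hx =>
    ⟨⟨r.integrand x, (hgraph x hx _).2 rfl⟩, fun t t' ht ht' => by
      rw [(hgraph x hx t).1 ht, (hgraph x hx t').1 ht']⟩
  have heq : T.hybrid p = r.integrand := by
    funext x
    by_cases hx : x ∈ T.fibre p
    · exact hybrid_eq_of_mem hf hx ((hgraph x hx _).2 rfl)
    · rw [hybrid_of_not_mem hx, hφ x hx]
  have h : T.SoloInformedAdmI p := ⟨hf, by rw [heq, ← hdom]; exact r.integrableOn⟩
  exact KZOver.IntegralRep.ext (by rw [repI_domain h, hdom]) (by rw [repI_integrand h, heq])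

/-- **Rational parameters.** If the fibres at an I-admissible `p` are `ℚ`-semialgebraic, the
denoted representation is the base change of a `ℚ`-representation with the same domain and
integrand. [cite: KontsevichZagier2001, §1.1] -/
def ratRepI (hS : IsSemialgebraic ℚ (T.fibre p)) (hG : IsSemialgebraic ℚ (T.gfibre p))
    (h : T.SoloInformedAdmI p) : KZOver.IntegralRep ℚ d where
  domain := T.fibre p
  integrand := T.hybrid p
  isSemialgebraic_domain := hS
  isSemialgebraicFunOn_integrand := isSemialgebraicFunOn_hybrid_of hS hG h.1
  integrableOn := h.2

/-- The base change of the rational representation is the denoted one.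
[cite: KontsevichZagier2001, §1.1] -/
theorem baseChange_ratRepI (hS : IsSemialgebraic ℚ (T.fibre p))
    (hG : IsSemialgebraic ℚ (T.gfibre p)) (h : T.SoloInformedAdmI p) :
    (ratRepI hS hG h).baseChange ℝ = T.repI p :=
  KZOver.IntegralRep.ext (by rw [repI_domain h]; rfl) (by rw [repI_integrand h]; rfl)

/-! ### Pull-back -/

variable (T) (θ : K → K') (p' : K' → ℝ)

/-- I-admissibility is invariant under pull-back. [cite: KontsevichZagier2001, §1.1] -/
theorem admI_pullback_iff :
    (T.pullback θ).SoloInformedAdmI p' ↔ T.SoloInformedAdmI (p' ∘ θ) := by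
  rw [SoloInformedAdmI, SoloInformedAdmI, functional_pullback_iff, fibre_pullback, hybrid_pullback]

/-- **The denoted representation is invariant under pull-back.**
[cite: KontsevichZagier2001, §1.1] -/
theorem repI_pullback : (T.pullback θ).repI p' = T.repI (p' ∘ θ) := by
  by_cases h : T.SoloInformedAdmI (p' ∘ θ)
  · have h' : (T.pullback θ).SoloInformedAdmI p' := (admI_pullback_iff T θ p').2 h
    exact KZOver.IntegralRep.ext (by rw [repI_domain h', repI_domain h, fibre_pullback])
      (by rw [repI_integrand h', repI_integrand h, hybrid_pullback])
  · have h' : ¬ (T.pullback θ).SoloInformedAdmI p' := fun h' => h ((admI_pullback_iff T θ p').1 h')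
    rw [repI_of_not_admI h', repI_of_not_admI h]
    rfl

/-! ### The I-admissible locus -/

/-- **The I-admissible locus is `ℚ`-semialgebraic** (conditional on the Lion–Rolin preparation
fact): KERNEL LEMMA I in parameter coordinates. [cite: ComteLionRolin2000, Thm. 3] -/
theorem isSemialgebraic_setOf_admI (hprep : semialgebraicPreparation) [Finite K]
    (T : SoloInformedPTerm K d) : IsSemialgebraic ℚ {p : K → ℝ | T.SoloInformedAdmI p} :=
  isSemialgebraic_setOf_functional_integrableOn hprep T

end SoloInformedPTerm

end Summit.KontsevichZagierPeriods.KontsevichZagierPeriods.Theorems
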